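import Literature.NumberTheory.EllipticCurves.Curve6137PhiSideSelmer
import Literature.NumberTheory.EllipticCurves.CPMuDescentShaThree
import HarnessLib

/-!
# The `φ`-side of the `3`-isogeny descent from the `α̂`-box over `ℚ(√−3)`, and the complete criterion
# `t_3(E) = 0` from the two boxes (Cohen–Pazuki 2009, Prop. 1.4 (2), Thm. 2.1, Prop. 2.2) — generic in `E_{m,s}/ℚ`

Topic `NumberTheory/EllipticCurves`. Curve-independent form of `Curve6137PhiSideSelmer` (the carrier
`y² − 21xy + 6137y = x³` is the instance `(m, s) = (−21/2, 6137/2)`, `a₃ = (7/2)θ₀`, `b₃ = −(6137/6)θ₀`).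
For `E = threeTorsionModel m s` over `ℚ` (rational `3`-torsion point `T = (0, s)`, Vélu isogeny
`φ : E → Ê` with kernel `⟨T⟩ ≅ ℤ/3`), a class `c ∈ Ш(E/ℚ)` with `φ_* c = 0` is `[σ ↦ n(σ)T]` for a cubic
character `n` (`ThreeKernelCocycles`); restricted to `K3 = ℚ(ζ₃)` it is the Kummer character of some
`u ∈ K3*` whose NORM IS A CUBE (`K3CubicCharacterNorm`), i.e. the `μ₃`-torsor class `[C_u]` of the
Cohen–Pazuki model `cpCurve a₃ b₃ = E_{K3}` (`a₃ = a₃(θ₀)`, `b₃ = b₃(θ₀)` with `b₃θ₀ = s`, for `θ₀ = ±√−3 ∈ K3`);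
so if the `α̂`-BOX over `K3` is sharp — every such norm-cube torsor class lying in `Ш(E/K3)` vanishes, a
statement a curve file proves from its rational points (e.g. `Curve6137PhiSideK3`) — then `res c = 0`, and
`c = 0` because restriction is injective on `Ш[3]` (`3 ∤ [K3 : ℚ] = 2`, `ShaRestrictionIndex`):

* **`CPMuDescent.eq_zero_of_mem_sha_of_galH1Map_geomHom_eq_zero_of_box`** — `Ш(E/ℚ) ∩ ker φ_* = 0` from the
  `K3`-box;
* **`CPMuDescent.forall_mem_sha_three_nsmul_eq_zero_of_boxes`, `CPMuDescent.shaCorank_three_eq_zero_of_boxes`**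
  — with the `φ̂`-side box over `ℚ` (`CPMuDescentShaThree.forall_mem_sha_three_nsmul_eq_zero_of_sharp`):
  BOTH boxes sharp ⇒ `Ш(E/ℚ)[3] = 0`, `t_3(E) = 0`. A cross-prime cell at `3` of an explicit `E_{m,s}` is
  thereby reduced to exactly its two box statements.

## References

* [CohenPazuki2009] H. Cohen, F. Pazuki, Acta Arith. 140 (2009), Prop. 1.4 (2), Thm. 2.1, Prop. 2.2.
* [SilvermanAEC2009] J. H. Silverman, *AEC*, Thm. X.4.2 (a), App. B §2.
-/

noncomputable section

open scoped Classical

open WeierstrassCurve IsDedekindDomain NumberField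

namespace Literature.NumberTheory.EllipticCurves

namespace CPMuDescent

open MordellDescent MuThreeKernel GaloisRepresentations
open Literature.NumberTheory.NumberFields Literature.NumberTheory.NumberFields.K3

/-- Transport of an explicit `Ш`-class along an equality of curves (private helper). [cite: SilvermanAEC2009, App. B §2] -/
private theorem sha_transport {L : Type} [Field L] [NumberField L] {W₁ W₂ : WeierstrassCurve L}
    (h : W₁ = W₂) (k : Field.absoluteGaloisGroup L → ℕ) (y : AlgebraicClosure L)
    (hns₁ : (W₁.baseChange (AlgebraicClosure L)).toAffine.Nonsingular 0 y)
    (hns₂ : (W₂.baseChange (AlgebraicClosure L)).toAffine.Nonsingular 0 y)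
    (g₁ : contOneCocycles (discreteTopRep (Field.absoluteGaloisGroup L) (geomPoints W₁)))
    (hg₁ : ∀ τ, g₁.1 τ = k τ • (Affine.Point.some 0 y hns₁ : geomPoints W₁))
    (g₂ : contOneCocycles (discreteTopRep (Field.absoluteGaloisGroup L) (geomPoints W₂)))
    (hg₂ : ∀ τ, g₂.1 τ = k τ • (Affine.Point.some 0 y hns₂ : geomPoints W₂))
    (hsha : oneCocycleClass _ g₁ ∈ W₁.sha) :
    oneCocycleClass _ g₂ ∈ W₂.sha ∧ (oneCocycleClass _ g₂ = 0 → oneCocycleClass _ g₁ = 0) := by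
  subst h
  have : g₁ = g₂ := Subtype.ext (ContinuousMap.ext fun τ => by rw [hg₁, hg₂])
  subst this
  exact ⟨hsha, id⟩

/-- **`Ш(E/ℚ) ∩ ker φ_* = 0` from the `α̂`-box over `K3 = ℚ(√−3)`** (`E = threeTorsionModel m s`, `φ` Vélu's
`3`-isogeny with kernel `⟨(0, s)⟩`). The box datum: Cohen–Pazuki coefficients `a₃(θ₀), b₃(θ₀) ∈ K3` for each
square root `θ₀` of `−3` with `cpCurve (a₃ θ₀) (b₃ θ₀) = E_{K3}` and `b₃θ₀ = s` (so `T̂ = (0, b₃√−3) = (0, s)`),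
and the SHARPNESS `hbox`: every `μ₃`-torsor class `[C_u]`, `u ∈ K3*` of cube norm, lying in `Ш(E/K3)` vanishes.
[cite: CohenPazuki2009, Proposition 1.4 (2), Theorem 2.1 and Proposition 2.2] [cite: SilvermanAEC2009, Thm. X.4.2 (a)] -/
theorem eq_zero_of_mem_sha_of_galH1Map_geomHom_eq_zero_of_box {m s : ℚ} [(threeTorsionModel m s).IsElliptic]
    (a₃ b₃ : K3 → K3) (hb₃ : ∀ θ₀ : K3, θ₀ ^ 2 = -3 → b₃ θ₀ ≠ 0)
    (hd₃ : ∀ θ₀ : K3, θ₀ ^ 2 = -3 → 4 * a₃ θ₀ ^ 3 + 9 * b₃ θ₀ ≠ 0)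
    (hX₃ : ∀ θ₀ : K3, θ₀ ^ 2 = -3 → (threeTorsionModel m s).baseChange K3 = cpCurve (a₃ θ₀) (b₃ θ₀))
    (hy : ∀ θ₀ : K3, θ₀ ^ 2 = -3 → b₃ θ₀ * θ₀ = algebraMap ℚ K3 s)
    (hbox : ∀ (θ₀ : K3) (hθ : θ₀ ^ 2 = -3) {u : K3} (hu : u ≠ 0),
      (kernelDatum (hb₃ θ₀ hθ) (hd₃ θ₀ hθ)).torsorClass hu ∈ (cpCurve (a₃ θ₀) (b₃ θ₀)).sha →
        (∃ r : ℚ, QuadraticAlgebra.norm u = r ^ 3) → (kernelDatum (hb₃ θ₀ hθ) (hd₃ θ₀ hθ)).torsorClass hu = 0)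
    (hV : IsVeluThreePair m s (threeTorsionModel m s) (threeIsogenyCodomain m s))
    {c : (threeTorsionModel m s).galH1} (hc : c ∈ (threeTorsionModel m s).sha)
    (h0 : galH1Map hV.geomHom hV.geomHom_smul c = 0) : c = 0 := by
  -- Step A: `c = [σ ↦ n(σ) T]` for a cubic character `n`
  have hT0 : hV.geomT ≠ 0 := hV.geomT_ne_zero
  have hTT : hV.geomT + hV.geomT = -hV.geomT := hV.geom.T_add_T
  have hfix : ∀ σ : Field.absoluteGaloisGroup ℚ,
      σ • (hV.geomT : geomPoints (threeTorsionModel m s)) = hV.geomT := hV.smul_geomT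
  have hker : ∀ P : geomPoints (threeTorsionModel m s),
      hV.geomHom P = 0 → P = 0 ∨ P = hV.geomT ∨ P = -hV.geomT := by
    intro P hP
    have : P ∈ (hV.geomHom.ker : Set (geomPoints (threeTorsionModel m s))) := hP
    rw [hV.ker_geomHom] at this
    simpa only [Set.mem_insert_iff, Set.mem_singleton_iff] using this
  have hsurj : Function.Surjective hV.geomHom := hV.geom.pointFun_surjective
  obtain ⟨g, n, hg, hn, hlc, hgc⟩ :=
    exists_hom_of_galH1Map_eq_zero hV.geomT hT0 hTT hfix hV.geomHom hV.geomHom_smul hsurj hker c h0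
  -- Step B: the restricted character is the Kummer character of `u ∈ K3*` of cube norm
  obtain ⟨u, hu, hκ, hnorm⟩ := exists_kummerExp_eq_resGal_and_norm_eq_cube n hn hlc
  -- Step C: `θ₀ ∈ K3` with `θ₀ ↦ √−3` in `K̄3`; the `μ₃`-kernel datum of `E_{K3} = cpCurve a₃ b₃`
  obtain ⟨θ₀, hθ, hθalg⟩ : ∃ θ₀ : K3, θ₀ ^ 2 = -3 ∧ algebraMap K3 (AlgebraicClosure K3) θ₀ = theta K3 := by
    rcases theta_K3_eq_or with h | h
    · exact ⟨K3.theta, K3.theta_sq, h.symm⟩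
    · exact ⟨-K3.theta, by rw [neg_sq, K3.theta_sq], by rw [map_neg]; exact h.symm⟩
  set 𝒯 := kernelDatum (hb₃ θ₀ hθ) (hd₃ θ₀ hθ) with h𝒯
  have hcurves : (threeTorsionModel m s).baseChange K3 = cpCurve (a₃ θ₀) (b₃ θ₀) := hX₃ θ₀ hθ
  -- the common `y`-coordinate `s` of the kernel points
  set y₀ : AlgebraicClosure K3 := algebraMap K3 (AlgebraicClosure K3) (algebraMap ℚ K3 s) with hy₀
  have hyeq : algebraMap K3 (AlgebraicClosure K3) (b₃ θ₀) * theta K3 = y₀ := by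
    rw [← hθalg, ← map_mul, hy θ₀ hθ]
  have hns₂ : ((cpCurve (a₃ θ₀) (b₃ θ₀)).baseChange (AlgebraicClosure K3)).toAffine.Nonsingular 0 y₀ := by
    have := (isVeluThreePair_geom (hb₃ θ₀ hθ) (hd₃ θ₀ hθ)).nonsingular_T
    rwa [hyeq] at this
  have hns₁ : (((threeTorsionModel m s).baseChange K3).baseChange
      (AlgebraicClosure K3)).toAffine.Nonsingular 0 y₀ := by
    rw [hcurves]; exact hns₂
  -- the restricted class `res c = [τ ↦ n(τ|_ℚ̄) · (0, y₀)]`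
  obtain ⟨g₁, hg₁, hres⟩ := resBaseChange_oneCocycleClass (threeTorsionModel m s) K3 g
  have hy' : iotaE (K := ℚ) K3 (algebraMap ℚ (AlgebraicClosure ℚ) s) = y₀ := by
    have e0 : iotaE (K := ℚ) K3 (algebraMap ℚ (AlgebraicClosure ℚ) s) =
        algebraMap ℚ (AlgebraicClosure K3) s := (iotaE (K := ℚ) K3).commutes _
    rw [e0, IsScalarTower.algebraMap_apply ℚ K3 (AlgebraicClosure K3), hy₀]
  have hns' : ((threeTorsionModel m s).baseChange (AlgebraicClosure K3)).toAffine.Nonsingular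
      (iotaE (K := ℚ) K3 0) (iotaE (K := ℚ) K3 (algebraMap ℚ (AlgebraicClosure ℚ) s)) := by
    rw [map_zero, hy', ← baseChange_baseChange (threeTorsionModel m s) K3 (AlgebraicClosure K3)]
    exact hns₁
  have hT_L : localPointsEquivGeomPoints (threeTorsionModel m s) K3
      (pointsMap (threeTorsionModel m s) K3 hV.geomT) = Affine.Point.some 0 y₀ hns₁ := by
    have e1 : pointsMap (threeTorsionModel m s) K3 hV.geomT =
        (show localPoints (threeTorsionModel m s) K3 from Affine.Point.some _ _ hns') :=
      pointsMap_some hV.geom.nonsingular_T hns'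
    rw [e1]
    change Affine.Point.congrEquiv (baseChange_baseChange (threeTorsionModel m s) K3
      (AlgebraicClosure K3)).symm (Affine.Point.some _ _ hns') = _
    rw [Affine.Point.congrEquiv_some]
    exact point_some_ext (map_zero _) hy'
  have hg₁' : ∀ τ, g₁.1 τ = (n (resGal (K := ℚ) K3 τ)).val •
      (Affine.Point.some 0 y₀ hns₁ : geomPoints ((threeTorsionModel m s).baseChange K3)) := by
    intro τ; rw [hg₁, hg, map_nsmul, map_nsmul, hT_L]; rfl
  -- the torsor cocycle of `u` on `cpCurve a₃ b₃` has the same values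
  have hT₃ : 𝒯.T = Affine.Point.some 0 y₀ hns₂ := by
    rw [h𝒯, kernelDatum_T, CPMuDescent.torsT_eq]
    exact point_some_ext rfl hyeq
  have hg₂ : ∀ τ, (𝒯.torsorCocycle hu).1 τ = (n (resGal (K := ℚ) K3 τ)).val •
      (Affine.Point.some 0 y₀ hns₂ : geomPoints (cpCurve (a₃ θ₀) (b₃ θ₀))) := by
    intro τ
    rw [MuThreeKernel.torsorCocycle_apply, MuThreeKernel.torsorFun, MuThreeKernel.chiT_eq_val_nsmul, hκ, hT₃]
    rfl
  -- `res c ∈ Ш(E_{K3}/K3)`, transported to `cpCurve a₃ b₃`, is `[C_u]`, which vanishes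
  have hres_sha : oneCocycleClass _ g₁ ∈ ((threeTorsionModel m s).baseChange K3).sha := by
    rw [← hres]; exact resBaseChange_mem_sha _ K3 (hgc ▸ hc)
  obtain ⟨hsha₃, hback⟩ := sha_transport hcurves (fun τ => (n (resGal (K := ℚ) K3 τ)).val) y₀ hns₁ hns₂
    g₁ hg₁' (𝒯.torsorCocycle hu) hg₂ hres_sha
  have hzero₃ : oneCocycleClass _ (𝒯.torsorCocycle hu) = 0 := hbox θ₀ hθ hu hsha₃ hnorm
  have hres0 : resBaseChange (threeTorsionModel m s) K3 c = 0 := by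
    rw [← hgc, hres]; exact hback hzero₃
  -- restriction is injective on `Ш[3]`
  haveI : IsGalois ℚ K3 := IsCyclotomicExtension.isGalois {3} ℚ K3
  set c' : (threeTorsionModel m s).sha := ⟨c, hc⟩ with hc'
  have h3T : (3 : ℕ) • hV.geomT = 0 := by rw [succ_nsmul, two_nsmul, hTT, neg_add_cancel]
  have h3 : 3 • c' = 0 := by
    apply Subtype.ext
    change 3 • c = 0
    rw [← hgc]
    refine nsmul_oneCocycleClass_eq_zero _ 3 fun σ => ?_
    rw [hg, ← mul_nsmul, mul_comm, mul_nsmul, h3T, nsmul_zero]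
  have hres' : shaRestriction (threeTorsionModel m s) K3 c' = 0 :=
    Subtype.ext (by rw [coe_shaRestriction_apply]; exact hres0)
  have hcop : Nat.Coprime 3 (Module.finrank ℚ K3) := by rw [finrank_eq]; decide
  have := (shaRestriction_eq_zero_iff_of_coprime (threeTorsionModel m s) K3 hcop c' h3).mp hres'
  exact congrArg Subtype.val this

/-- `−3` is not a square in `ℚ`. [cite: CohenPazuki2009, §1.2] -/
theorem rat_sq_ne_neg_three (q : ℚ) : q ^ 2 ≠ -3 := fun h => by nlinarith [sq_nonneg q]

/-- **`Ш(E/ℚ)[3] = 0` from the two boxes of the `3`-isogeny descent** (`E = threeTorsionModel m s` over `ℚ`):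
the `α`-box over `ℚ` sharp (`hhat`, for a Cohen–Pazuki model `cpCurve a b = C • Ê` of the Vélu quotient)
and the `α̂`-box over `ℚ(√−3)` sharp (`hbox`) ⇒ every class of `Ш(E/ℚ)` killed by `3` vanishes.
[cite: CohenPazuki2009, Proposition 2.2] [cite: SilvermanAEC2009, Thm. X.4.2 (a)] -/
theorem forall_mem_sha_three_nsmul_eq_zero_of_boxes {m s a b : ℚ} [(threeTorsionModel m s).IsElliptic]
    (hb : b ≠ 0) (hd : 4 * a ^ 3 + 9 * b ≠ 0) (C : VariableChange ℚ)
    (hX : cpCurve a b = C • threeIsogenyCodomain m s)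
    (hhat : ∀ {W' : WeierstrassCurve ℚ} (f : geomPoints (cpCurve a b) →+ geomPoints W')
        (hf : ∀ (σ : Field.absoluteGaloisGroup ℚ) (P : geomPoints (cpCurve a b)), f (σ • P) = σ • f P),
        Function.Surjective f →
          (∀ P, f P = 0 → P = 0 ∨ P = (kernelDatum hb hd).T ∨ P = -(kernelDatum hb hd).T) →
            ∀ {c : (cpCurve a b).galH1}, c ∈ (cpCurve a b).sha → galH1Map f hf c = 0 → c = 0)
    (a₃ b₃ : K3 → K3) (hb₃ : ∀ θ₀ : K3, θ₀ ^ 2 = -3 → b₃ θ₀ ≠ 0)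
    (hd₃ : ∀ θ₀ : K3, θ₀ ^ 2 = -3 → 4 * a₃ θ₀ ^ 3 + 9 * b₃ θ₀ ≠ 0)
    (hX₃ : ∀ θ₀ : K3, θ₀ ^ 2 = -3 → (threeTorsionModel m s).baseChange K3 = cpCurve (a₃ θ₀) (b₃ θ₀))
    (hy : ∀ θ₀ : K3, θ₀ ^ 2 = -3 → b₃ θ₀ * θ₀ = algebraMap ℚ K3 s)
    (hbox : ∀ (θ₀ : K3) (hθ : θ₀ ^ 2 = -3) {u : K3} (hu : u ≠ 0),
      (kernelDatum (hb₃ θ₀ hθ) (hd₃ θ₀ hθ)).torsorClass hu ∈ (cpCurve (a₃ θ₀) (b₃ θ₀)).sha →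
        (∃ r : ℚ, QuadraticAlgebra.norm u = r ^ 3) → (kernelDatum (hb₃ θ₀ hθ) (hd₃ θ₀ hθ)).torsorClass hu = 0) :
    ∀ c ∈ (threeTorsionModel m s).sha, 3 • c = 0 → c = 0 :=
  forall_mem_sha_three_nsmul_eq_zero_of_sharp rat_sq_ne_neg_three hb hd C hX @hhat
    fun hV _ hc h0 => eq_zero_of_mem_sha_of_galH1Map_geomHom_eq_zero_of_box a₃ b₃ hb₃ hd₃ hX₃ hy hbox hV hc h0

/-- **`t_3(E) = corank_{ℤ₃} Ш(E/ℚ)[3^∞] = 0` from the two boxes** — the complete `3`-isogeny descent criterion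
for `E_{m,s}/ℚ`, kernel-checked: a cross-prime cell at `3` needs exactly the two box statements `hhat`, `hbox`.
[cite: CohenPazuki2009, Proposition 2.2] [cite: SilvermanAEC2009, Thm. X.4.2 (a)] -/
theorem shaCorank_three_eq_zero_of_boxes {m s a b : ℚ} [(threeTorsionModel m s).IsElliptic]
    (hb : b ≠ 0) (hd : 4 * a ^ 3 + 9 * b ≠ 0) (C : VariableChange ℚ)
    (hX : cpCurve a b = C • threeIsogenyCodomain m s)
    (hhat : ∀ {W' : WeierstrassCurve ℚ} (f : geomPoints (cpCurve a b) →+ geomPoints W')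
        (hf : ∀ (σ : Field.absoluteGaloisGroup ℚ) (P : geomPoints (cpCurve a b)), f (σ • P) = σ • f P),
        Function.Surjective f →
          (∀ P, f P = 0 → P = 0 ∨ P = (kernelDatum hb hd).T ∨ P = -(kernelDatum hb hd).T) →
            ∀ {c : (cpCurve a b).galH1}, c ∈ (cpCurve a b).sha → galH1Map f hf c = 0 → c = 0)
    (a₃ b₃ : K3 → K3) (hb₃ : ∀ θ₀ : K3, θ₀ ^ 2 = -3 → b₃ θ₀ ≠ 0)
    (hd₃ : ∀ θ₀ : K3, θ₀ ^ 2 = -3 → 4 * a₃ θ₀ ^ 3 + 9 * b₃ θ₀ ≠ 0)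
    (hX₃ : ∀ θ₀ : K3, θ₀ ^ 2 = -3 → (threeTorsionModel m s).baseChange K3 = cpCurve (a₃ θ₀) (b₃ θ₀))
    (hy : ∀ θ₀ : K3, θ₀ ^ 2 = -3 → b₃ θ₀ * θ₀ = algebraMap ℚ K3 s)
    (hbox : ∀ (θ₀ : K3) (hθ : θ₀ ^ 2 = -3) {u : K3} (hu : u ≠ 0),
      (kernelDatum (hb₃ θ₀ hθ) (hd₃ θ₀ hθ)).torsorClass hu ∈ (cpCurve (a₃ θ₀) (b₃ θ₀)).sha →
        (∃ r : ℚ, QuadraticAlgebra.norm u = r ^ 3) → (kernelDatum (hb₃ θ₀ hθ) (hd₃ θ₀ hθ)).torsorClass hu = 0) :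
    (threeTorsionModel m s).shaCorank 3 = 0 :=
  haveI : Fact (Nat.Prime 3) := ⟨Nat.prime_three⟩
  shaCorank_eq_zero_of_forall _ 3
    (forall_mem_sha_three_nsmul_eq_zero_of_boxes hb hd C hX @hhat a₃ b₃ hb₃ hd₃ hX₃ hy hbox)

/-! ## The carrier, re-derived through the generic criterion (sanity instance) -/

/-- The `K3`-box datum of the carrier `E₆₁₃₇` in generic form: `a₃(θ₀) = (7/2)θ₀`, `b₃(θ₀) = −(6137/6)θ₀`,
`b₃θ₀ = 6137/2`, `E_{K3} = cpCurve a₃ b₃`; whence `Ш(E₆₁₃₇/ℚ) ∩ ker φ_* = 0` AGAIN, now as an instance of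
`eq_zero_of_mem_sha_of_galH1Map_geomHom_eq_zero_of_box` (agrees with `Carrier6137.eq_zero_of_mem_sha_of_galH1Map_geomHom_eq_zero`).
[cite: CohenPazuki2009, Proposition 2.2] -/
theorem carrier6137_phiSide_of_box (hV : IsVeluThreePair (-21 / 2 : ℚ) (6137 / 2)
      (threeTorsionModel (-21 / 2 : ℚ) (6137 / 2)) (threeIsogenyCodomain (-21 / 2 : ℚ) (6137 / 2)))
    {c : (threeTorsionModel (-21 / 2 : ℚ) (6137 / 2)).galH1}
    (hc : c ∈ (threeTorsionModel (-21 / 2 : ℚ) (6137 / 2)).sha)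
    (h0 : galH1Map hV.geomHom hV.geomHom_smul c = 0) : c = 0 := by
  haveI := Carrier6137.isElliptic_W
  refine eq_zero_of_mem_sha_of_galH1Map_geomHom_eq_zero_of_box (fun θ₀ => (7 / 2 : K3) * θ₀)
    (fun θ₀ => -(6137 / 6 : K3) * θ₀) (fun θ₀ hθ => Carrier6137.hb₃ hθ) (fun θ₀ hθ => Carrier6137.hd₃ hθ)
    (fun θ₀ hθ => ?_) (fun θ₀ hθ => ?_) (fun θ₀ hθ u hu hsha hnorm =>
      Carrier6137.torsorClass_eq_zero_of_mem_sha_of_norm_cube hθ hu hsha hnorm) hV hc h0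
  · rw [Carrier6137.cpCurve_eq_threeTorsionModel hθ, WeierstrassCurve.baseChange, map_threeTorsionModel]
    congr 1 <;> simp [map_div₀]
  · rw [map_div₀, map_ofNat, map_ofNat]
    linear_combination (-6137 / 6 : K3) * hθ

end CPMuDescent

end Literature.NumberTheory.EllipticCurves

end
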